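import Literature.LinearAlgebra.TateResidue.TateResidue
import HarnessLib

/-!
# Tate's rule (R4) with a multiplier: `res_A(h g⁻¹ dg) = Tr_{A/gA}(h)` (Tate 1968, §2, (R4))

Companion to `Literature.LinearAlgebra.TateResidue.TateResidue`, which proves Tate's rule (R4) in the
special case `h = 1`: `res_A(g⁻¹ dg) = dim_K(A/gA)` (`res_inv_eq_finrank`). This file proves the rule as
printed, with an arbitrary multiplier `h` that maps `A` into itself and commutes with `g`:

* `res_mul_inv_eq_trace`: if `g'g = 1`, `gA ⊆ A`, `hA ⊆ A`, `hg = gh` and `A/gA` is finite-dimensional,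
  then `res_A(h g' dg) = Tr_{A/gA}(h̄)`, where `h̄ = quotMap …` is the endomorphism of `A/gA` induced by
  `h` (Tate 1968, §2, (R4): "if `g` is invertible and `gA ⊂ A`, `hA ⊂ A`, then
  `res_A(h g⁻¹ dg) = Tr_{A/gA}(h̄)`").

Proof (Tate's): with `π` a projection onto `A`, `θ = [π h g', g] = πh - gπhg'` maps `V` into `A`,
kills `gA`, and is `≡ h (mod gA)` on `A`; so `θ` factors through the finite-dimensional `A/gA`,
`Tr_V θ = Tr_W(θ|_W)` for `W = θ(A)`, and `θ|_W = β ∘ α`, `α ∘ β = h̄` for the obvious maps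
`α : W → A/gA`, `β : A/gA → W`, whence `Tr_W(θ|_W) = Tr_{A/gA}(h̄)`.

Downstream use (`Literature.NumberTheory.DiophantineGeometry.FunctionFieldResidueTrace`): the local
residue `res_P(h π⁻¹ dπ) = Tr_{F_P/K}(h(P))` at an ARBITRARY (not necessarily rational) place `P` of a
function field, the non-vanishing of `dπ`, and `(dπ)_P = 0` for a local parameter `π`.

## References

* J. Tate, *Residues of differentials on curves*, Ann. Sci. École Norm. Sup. (4) 1 (1968), 149–159,
  §2, rule (R4). [Tate1968]
-/

noncomputable section

open Module LinearMap Submodule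

namespace Literature.LinearAlgebra.TateResidue.Tate

universe u v

variable {K : Type u} {V : Type v} [Field K] [AddCommGroup V] [Module K V]

/-- `gA` viewed as a subspace of `A` (for `gA ⊆ A`): the kernel of `A → A/gA`. [cite: Tate1968, §2, (R4)] -/
def mapComap (A : Submodule K V) (g : Module.End K V) : Submodule K A :=
  (A.map g).comap A.subtype

/-- Membership in `mapComap A g`: `x ∈ gA`. [folklore] -/
theorem mem_mapComap_iff {A : Submodule K V} {g : Module.End K V} (x : A) :
    x ∈ mapComap A g ↔ (x : V) ∈ A.map g :=
  Iff.rfl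

variable {A : Submodule K V} {g g' h : Module.End K V}

/-- If `h` commutes with `g` and preserves `A`, then `h` preserves `gA`. [folklore] -/
theorem mapComap_le_comap_restrict (hhA : ∀ x ∈ A, h x ∈ A) (hhg : Commute h g) :
    mapComap A g ≤ (mapComap A g).comap (h.restrict hhA) := by
  intro x hx
  obtain ⟨a, ha, hax⟩ := (mem_mapComap_iff x).1 hx
  rw [Submodule.mem_comap, mem_mapComap_iff, LinearMap.coe_restrict_apply, ← hax]
  have hcomm : h (g a) = g (h a) := by
    have := congrArg (fun φ : Module.End K V => φ a) hhg.eq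
    simpa [Module.End.mul_apply] using this
  rw [hcomm]
  exact Submodule.mem_map_of_mem (hhA a ha)

/-- **The endomorphism `h̄` of `A/gA` induced by `h`** (for `hA ⊆ A`, `hg = gh`).
[cite: Tate1968, §2, (R4)] -/
def quotMap (A : Submodule K V) (g h : Module.End K V) (hhA : ∀ x ∈ A, h x ∈ A)
    (hhg : Commute h g) : (A ⧸ mapComap A g) →ₗ[K] (A ⧸ mapComap A g) :=
  (mapComap A g).mapQ (mapComap A g) (h.restrict hhA) (mapComap_le_comap_restrict hhA hhg)

/-- `h̄ [a] = [h a]`. [folklore] -/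
theorem quotMap_mk (hhA : ∀ x ∈ A, h x ∈ A) (hhg : Commute h g) (a : A) :
    quotMap A g h hhA hhg (Submodule.Quotient.mk a) =
      Submodule.Quotient.mk (h.restrict hhA a) :=
  rfl

/-- **Tate's rule (R4) with a multiplier.** Let `g'g = 1`, `gA ⊆ A`, `hA ⊆ A`, `hg = gh`, and suppose
`A/gA` is finite-dimensional. Then `res_A(h g' dg) = Tr_{A/gA}(h̄)` (Tate 1968, §2, (R4); the case
`h = 1` is `res_inv_eq_finrank`). [cite: Tate1968, §2, (R4)] -/
theorem res_mul_inv_eq_trace (hg'g : g' * g = 1) (hgA : A.map g ≤ A) (hhA : ∀ x ∈ A, h x ∈ A)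
    (hhg : Commute h g) [FiniteDimensional K (A ⧸ mapComap A g)] :
    res A (h * g') g = trace K (A ⧸ mapComap A g) (quotMap A g h hhA hhg) := by
  set p := proj A with hp_def
  have hp := isProj_proj A
  -- `θ = [p h g', g] = p h - g p h g'`
  set θ : Module.End K V := p * (h * g') * g - g * (p * (h * g')) with hθ_def
  have hgg : ∀ v, g' (g v) = v := fun v => by
    rw [← Module.End.mul_apply, hg'g, Module.End.one_apply]
  have hθv : ∀ v, θ v = p (h v) - g (p (h (g' v))) := fun v => by
    simp only [hθ_def, LinearMap.sub_apply, Module.End.mul_apply, hgg]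
  have hcomm : ∀ v, h (g v) = g (h v) := fun v => by
    have := congrArg (fun φ : Module.End K V => φ v) hhg.eq
    simpa [Module.End.mul_apply] using this
  -- (1) `θ V ⊆ A`
  have hθV : ∀ v, θ v ∈ A := fun v => by
    rw [hθv]
    exact Submodule.sub_mem _ (hp.map_mem _) (hgA (Submodule.mem_map_of_mem (hp.map_mem _)))
  have hθA : ∀ x ∈ A, θ x ∈ A := fun x _ => hθV x
  -- (2) `θ (g a) = 0` for `a ∈ A`
  have hθg : ∀ a ∈ A, θ (g a) = 0 := fun a ha => by
    rw [hθv, hgg, hcomm, hp.map_id _ (hgA (Submodule.mem_map_of_mem (hhA a ha))),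
      hp.map_id _ (hhA a ha), sub_self]
  -- (3) `θ a ≡ h a (mod gA)` for `a ∈ A`
  have hθh : ∀ a ∈ A, θ a - h a ∈ A.map g := fun a ha => by
    rw [hθv, hp.map_id _ (hhA a ha), sub_sub_cancel_left]
    exact Submodule.neg_mem _ (Submodule.mem_map_of_mem (hp.map_mem _))
  -- `θ|_A` factors through `A/gA`
  set θA : A →ₗ[K] A := θ.restrict hθA with hθA_def
  have hker : mapComap A g ≤ LinearMap.ker θA := by
    intro x hx
    obtain ⟨a, ha, hax⟩ := (mem_mapComap_iff x).1 hx
    rw [LinearMap.mem_ker]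
    apply Subtype.ext
    rw [hθA_def, LinearMap.coe_restrict_apply, ← hax, hθg a ha]
    rfl
  set θq : (A ⧸ mapComap A g) →ₗ[K] A := (mapComap A g).liftQ θA hker with hθq_def
  have hθq : ∀ a : A, θq (Submodule.Quotient.mk a) = θA a := fun a =>
    Submodule.liftQ_apply _ _ a
  -- `W = θ(A)`, a finite-dimensional `θ`-invariant subspace containing `θ² V`
  set W : Submodule K V := LinearMap.range (A.subtype ∘ₗ θq) with hW_def
  have hWA : W ≤ A := by
    rintro _ ⟨x, rfl⟩
    exact (θq x).2
  have hθW : ∀ a ∈ A, θ a ∈ W := fun a ha =>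
    ⟨Submodule.Quotient.mk ⟨a, ha⟩, by
      rw [LinearMap.comp_apply, hθq, Submodule.subtype_apply, hθA_def,
        LinearMap.coe_restrict_apply]⟩
  have hW : ∀ x ∈ W, θ x ∈ W := fun x hx => hθW x (hWA hx)
  have hm : LinearMap.range (θ ^ 2) ≤ W := by
    rintro _ ⟨v, rfl⟩
    rw [pow_two, Module.End.mul_apply]
    exact hθW _ (hθV v)
  have htr : fpTrace θ = trace K W (θ.restrict hW) := fpTrace_eq_trace_restrict hW hm
  -- `θ|_W = β ∘ α`, `α ∘ β = h̄`
  set α : W →ₗ[K] (A ⧸ mapComap A g) := (mapComap A g).mkQ ∘ₗ Submodule.inclusion hWA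
    with hα_def
  set β : (A ⧸ mapComap A g) →ₗ[K] W :=
    LinearMap.codRestrict W (A.subtype ∘ₗ θq) (fun x => LinearMap.mem_range_self _ x) with hβ_def
  have hβα : θ.restrict hW = β ∘ₗ α := by
    ext ⟨w, hw⟩
    rw [LinearMap.coe_restrict_apply, LinearMap.comp_apply]
    simp only [hα_def, hβ_def, LinearMap.comp_apply, Submodule.mkQ_apply, LinearMap.codRestrict_apply]
    rw [hθq, Submodule.subtype_apply, hθA_def, LinearMap.coe_restrict_apply, Submodule.coe_inclusion]
  have hαβ : α ∘ₗ β = quotMap A g h hhA hhg := by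
    refine Submodule.linearMap_qext _ (LinearMap.ext fun a => ?_)
    simp only [LinearMap.comp_apply, Submodule.mkQ_apply, quotMap_mk]
    simp only [hα_def, LinearMap.comp_apply, Submodule.mkQ_apply]
    refine (Submodule.Quotient.eq _).2 ?_
    rw [mem_mapComap_iff, Submodule.coe_sub, Submodule.coe_inclusion, LinearMap.coe_restrict_apply]
    have hβa : ((β (Submodule.Quotient.mk a) : W) : V) = θ a := by
      simp only [hβ_def, LinearMap.codRestrict_apply, LinearMap.comp_apply]
      rw [hθq, Submodule.subtype_apply, hθA_def, LinearMap.coe_restrict_apply]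
    rw [hβa]
    exact hθh a a.2
  calc res A (h * g') g = fpTrace θ := rfl
    _ = trace K W (θ.restrict hW) := htr
    _ = trace K W (β ∘ₗ α) := by rw [hβα]
    _ = trace K (A ⧸ mapComap A g) (α ∘ₗ β) := LinearMap.trace_comp_comm' α β
    _ = trace K (A ⧸ mapComap A g) (quotMap A g h hhA hhg) := by rw [hαβ]

end Literature.LinearAlgebra.TateResidue.Tate

end
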